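import Summits.CriticalPhenomena.PercolationContinuityZ3.Theorems.PercNearOneGluingNoHeavyQuantAtomLaw
import Summits.CriticalPhenomena.PercolationContinuityZ3.Theorems.PercNearOneGluingNoHeavyQuantLawDecUsageMongeRates
import Summits.CriticalPhenomena.PercolationContinuityZ3.Theorems.PercNearOneGluingNoHeavyQuantCornerPrefix
import HarnessLib

/-!
# QUANT lane R8, T-DEC: (O1) IN A WINDOW-DEC ATOM WHOSE CHEAP SEGMENT STRADDLES, THE EXPENSIVE LOW IS THE LOWER LOW
# (census-2 g58: the first of the two order facts that cut `ConvClosedTAtoms` down to the atlas; the second — crossed absorbers — is an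
# extreme-point fact, `corner_staircase` in `…QuantWindowExtremeShape`)

builds on p205010 (kernel theorem, internal audit signed; external expert review pending)

Support file (`--supports stmt-CriticalPhenomena-4575`), QUANT lane seat prim-quant-census-2 (gen 58), rung R8 of
`run/shared/lean/prim/quant/LADDER.md`.  Theorems only, standard axioms, no sorries.  Memo `…/prim-quant-census-2-g58/EXTREME-ATOMS-G58.md` §3.

* `atomLaw_apply` — the four values of `atomLaw` when its positions are pairwise distinct.
* **`not_parallel_of_window`** — for admissible data (`AtomData x T j M l₁ h₁ l₂ h₂`) whose atom is DEC at every layer of `[j − a, j]` and whose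
  cheap segment straddles (`j < h₂ + a`; under `¬ BDECAtT` this is `straddle_of_not_bdecAtT`), NOT (`l₂ < l₁ ∧ h₁ ≤ h₂`).  With `h₁ = h₂` the cheap
  rate would be at least the expensive one (`usage_anti_low`); with `h₁ < h₂`, at the window layer `h₂ − 1` the absorber `h₂` is a giant of rate
  `u > c₂` carrying only `c₂·m₂`, and `h₁` (capacity `c₁·m₁`) is dearer for `l₂` than for `l₁`, so weak duality (`dual_le_of_decAtT`, prices `1/c₁`,
  `1/u`, large elsewhere; `1` on the lows) gives `m₁ + m₂ ≤ m₁ + (c₂/u)·m₂`, absurd.  EXACT CENSUS (this seat, `code/atomorder.py`, M ≤ 7, 11 floors):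
  0 / 39 471 window-DEC non-BDEC admissible atoms violate (O1) — consistent; 8 729 violate the absorber order (O2), which is therefore NOT a
  window-DEC fact but an extreme-point fact.

[this work]; nothing here is cited as a published result.  The gluing rows served [cite: KozmaNitzan2024, Conjecture 3 (p. 15)]; product
measure [cite: Grimmett1999, §1.3 p. 10].
-/

noncomputable section

namespace Summit.CriticalPhenomena.PercolationContinuityZ3.Theorems

namespace Quant

open Finset

namespace LawDec

/-! ### (O1): the expensive low is the lower low -/

/-- the values of the atom at its four positions (pairwise distinct case `h₁ ≠ h₂`). -/
theorem atomLaw_apply (x T : ℝ) (j l₁ h₁ l₂ h₂ : ℕ) (hl : l₁ ≠ l₂) (h12 : h₁ ≠ h₂) (hl1h1 : l₁ ≠ h₁) (hl1h2 : l₁ ≠ h₂)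
    (hl2h1 : l₂ ≠ h₁) (hl2h2 : l₂ ≠ h₂) :
    atomLaw x T j l₁ h₁ l₂ h₂ l₁ = (1 - x) / (usage x T j l₁ h₁ - usage x T j l₂ h₂) * (x / (1 - x) - usage x T j l₂ h₂) ∧
    atomLaw x T j l₁ h₁ l₂ h₂ l₂ = (1 - x) / (usage x T j l₁ h₁ - usage x T j l₂ h₂) * (usage x T j l₁ h₁ - x / (1 - x)) ∧
    atomLaw x T j l₁ h₁ l₂ h₂ h₁ =
      (1 - x) / (usage x T j l₁ h₁ - usage x T j l₂ h₂) * ((x / (1 - x) - usage x T j l₂ h₂) * usage x T j l₁ h₁) ∧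
    atomLaw x T j l₁ h₁ l₂ h₂ h₂ =
      (1 - x) / (usage x T j l₁ h₁ - usage x T j l₂ h₂) * ((usage x T j l₁ h₁ - x / (1 - x)) * usage x T j l₂ h₂) := by
  unfold atomLaw
  refine ⟨?_, ?_, ?_, ?_⟩
  · rw [if_pos rfl, if_neg hl1h1, if_neg hl, if_neg hl1h2]; ring
  · rw [if_neg (Ne.symm hl), if_neg hl2h1, if_pos rfl, if_neg hl2h2]; ring
  · rw [if_neg (Ne.symm hl1h1), if_pos rfl, if_neg (Ne.symm hl2h1), if_neg h12]; ring
  · rw [if_neg (Ne.symm hl1h2), if_neg (Ne.symm h12), if_neg (Ne.symm hl2h2), if_pos rfl]; ring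

/-- **(O1) THE EXPENSIVE LOW IS THE LOWER LOW.**  For admissible data whose atom is DEC at every layer of the window `[j − a, j]` and whose cheap
segment straddles (`j < h₂ + a`, e.g. from `straddle_of_not_bdecAtT`), the "parallel" order `l₂ < l₁ ∧ h₁ ≤ h₂` is impossible: with `h₁ = h₂`
the cheap rate would exceed the expensive one (`usage` is antitone in the low); with `h₁ < h₂`, at the window layer `h₂ − 1` the absorber `h₂` is a
giant (rate `u > c₂`) and `h₁` is dearer for `l₂` than for `l₁`, so the two lows cannot both be shipped — weak duality (`dual_le_of_decAtT`) with prices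
`1/c₁` at `h₁`, `1/u` at `h₂`, large elsewhere, and `1` on the lows gives `m₁ + m₂ ≤ m₁ + (c₂/u)·m₂`. [this work] -/
theorem not_parallel_of_window (x T : ℝ) (j M a l₁ h₁ l₂ h₂ : ℕ) (hx0 : 0 < x) (hx1 : x < 1) (hd : AtomData x T j M l₁ h₁ l₂ h₂)
    (hwin : ∀ J, J ≤ j → j ≤ J + a → DECAtT x T J M (atomLaw x T j l₁ h₁ l₂ h₂)) (hstr : j < h₂ + a) :
    ¬ (l₂ < l₁ ∧ h₁ ≤ h₂) := by
  classical
  rintro ⟨hl, hh⟩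
  obtain ⟨hl1, hl2⟩ := hd.lt_of
  have hd' := hd
  obtain ⟨a1, a2, a3, a4, a5, b1, b2, b3, b4, b5, hne, c2, c1⟩ := hd'
  have hu : 0 < x / (1 - x) := div_pos hx0 (by linarith)
  have h1x : 0 < 1 - x := by linarith
  rcases hh.eq_or_lt with heq | hlt
  · -- `h₁ = h₂`: the cheap rate is at least the expensive rate
    have := usage_anti_low x T j l₂ l₁ h₁ hx0 hx1 hl a2 (by rw [heq]; exact b5) (Or.inr (by linarith))
    rw [heq] at this c1
    linarith
  · -- `h₁ < h₂`: the layer `J = h₂ − 1`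
    obtain ⟨J, hJ⟩ : ∃ J, h₂ = J + 1 := ⟨h₂ - 1, by omega⟩
    have hJj : J ≤ j := by omega
    have hJa : j ≤ J + a := by omega
    have hdec := hwin J hJj hJa
    -- the masses
    have hl1h1 : l₁ ≠ h₁ := Nat.ne_of_lt hl1
    have hl2h2 : l₂ ≠ h₂ := Nat.ne_of_lt hl2
    have hl1h2 : l₁ ≠ h₂ := by omega
    have hl2h1 : l₂ ≠ h₁ := by omega
    obtain ⟨e1, e2, e3, e4⟩ := atomLaw_apply x T j l₁ h₁ l₂ h₂ hne (Nat.ne_of_lt hlt) hl1h1 hl1h2 hl2h1 hl2h2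
    set K := (1 - x) / (usage x T j l₁ h₁ - usage x T j l₂ h₂) with hK
    have hKpos : 0 < K := div_pos h1x (by linarith)
    set m₁ := K * (x / (1 - x) - usage x T j l₂ h₂) with hm₁
    set m₂ := K * (usage x T j l₁ h₁ - x / (1 - x)) with hm₂
    have hm₂pos : 0 < m₂ := mul_pos hKpos (by linarith)
    have hc₁pos : 0 < usage x T j l₁ h₁ := hu.trans c1
    have hμ0 : ∀ b, b ≠ l₁ → b ≠ l₂ → b ≠ h₁ → b ≠ h₂ → atomLaw x T j l₁ h₁ l₂ h₂ b = 0 := fun b n1 n2 n3 n4 =>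
      atomLaw_eq_zero x T j l₁ h₁ l₂ h₂ n1 n3 n2 n4
    -- rates at the layer `J`
    have hcJ₁ : usage x T J l₁ h₁ = usage x T j l₁ h₁ := usage_of_le_layers x T J j l₁ h₁ (by omega) a3
    have hcJ₂₁ : T < (l₂ : ℝ) + h₁ → usage x T j l₁ h₁ ≤ usage x T J l₂ h₁ := fun hm => by
      rw [usage_of_le_layers x T J j l₂ h₁ (by omega) a3]
      exact usage_anti_low x T j l₂ l₁ h₁ hx0 hx1 hl a2 hm (Or.inr (by linarith))
    have hcJ₂ : ∀ l, usage x T J l h₂ = x / (1 - x) := fun l => usage_giant_eq x T J l h₂ (by omega)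
    -- prices: `1/c₁` at `h₁`, `1/u` at `h₂`, a large constant elsewhere; `1` on every low
    set B : ℝ := ∑ h ∈ Finset.range (M + 1), (|1 / usage x T J l₁ h| + |1 / usage x T J l₂ h|) + 1 with hB
    have hBge : ∀ l h, (l = l₁ ∨ l = l₂) → h ≤ M → 0 < usage x T J l h → 1 ≤ usage x T J l h * B := by
      intro l h hl' hhM hpos
      have hmem : h ∈ Finset.range (M + 1) := Finset.mem_range.2 (Nat.lt_succ_of_le hhM)
      have hle : |1 / usage x T J l₁ h| + |1 / usage x T J l₂ h| ≤
          ∑ h ∈ Finset.range (M + 1), (|1 / usage x T J l₁ h| + |1 / usage x T J l₂ h|) :=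
        Finset.single_le_sum (f := fun h => |1 / usage x T J l₁ h| + |1 / usage x T J l₂ h|)
          (fun h _ => add_nonneg (abs_nonneg _) (abs_nonneg _)) hmem
      have hinv : 1 / usage x T J l h ≤ B := by
        rcases hl' with e | e
        · rw [e]; linarith [le_abs_self (1 / usage x T J l₁ h), abs_nonneg (1 / usage x T J l₂ h)]
        · rw [e]; linarith [le_abs_self (1 / usage x T J l₂ h), abs_nonneg (1 / usage x T J l₁ h)]
      calc (1 : ℝ) = usage x T J l h * (1 / usage x T J l h) := by field_simp
        _ ≤ usage x T J l h * B := mul_le_mul_of_nonneg_left hinv hpos.le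
    have hB0 : 0 ≤ B := by
      have : 0 ≤ ∑ h ∈ Finset.range (M + 1), (|1 / usage x T J l₁ h| + |1 / usage x T J l₂ h|) :=
        Finset.sum_nonneg fun h _ => add_nonneg (abs_nonneg _) (abs_nonneg _)
      linarith
    let β : ℕ → ℝ := fun h => if h = h₁ then 1 / usage x T j l₁ h₁ else if h = h₂ then (1 - x) / x else B
    let α : ℕ → ℝ := fun l => if l = l₁ ∨ l = l₂ then 1 else 0
    have hβ0 : ∀ h, 0 ≤ β h := fun h => by
      simp only [β]
      split_ifs
      · exact (one_div_pos.2 hc₁pos).le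
      · exact div_nonneg h1x.le hx0.le
      · exact hB0
    have hdual := dual_le_of_decAtT x T J M (atomLaw x T j l₁ h₁ l₂ h₂) hx0 hx1 hdec α β hβ0 (fun l h hlJ hlow hhM hcomp => ?_)
    · -- evaluate both sides
      have hh1J : h₁ ≤ J := by omega
      have hl1J : l₁ < J + 1 := by omega
      have hl2J : l₂ < J + 1 := by omega
      -- left side = m₁ + m₂
      have lhs : ∑ l ∈ Finset.range (J + 1), (if 2 * (l : ℝ) < T then α l * atomLaw x T j l₁ h₁ l₂ h₂ l else 0) = m₁ + m₂ := by
        rw [Finset.sum_eq_add_of_mem l₁ l₂ (Finset.mem_range.2 hl1J) (Finset.mem_range.2 hl2J) hne]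
        · rw [if_pos a2, if_pos b2]
          have ha1 : α l₁ = 1 := by show (if l₁ = l₁ ∨ l₁ = l₂ then (1:ℝ) else 0) = 1; rw [if_pos (Or.inl rfl)]
          have ha2 : α l₂ = 1 := by show (if l₂ = l₁ ∨ l₂ = l₂ then (1:ℝ) else 0) = 1; rw [if_pos (Or.inr rfl)]
          rw [ha1, ha2, e1, e2, one_mul, one_mul]
        · intro c _ hc
          by_cases hcl : 2 * (c : ℝ) < T
          · rw [if_pos hcl]
            have hac : α c = 0 := by show (if c = l₁ ∨ c = l₂ then (1:ℝ) else 0) = 0; rw [if_neg (not_or.2 ⟨hc.1, hc.2⟩)]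
            rw [hac, zero_mul]
          · rw [if_neg hcl]
      -- right side = m₁ + (c₂/u)·m₂
      have hh1M : h₁ < M + 1 := Nat.lt_succ_of_le a4
      have hh2M : h₂ < M + 1 := Nat.lt_succ_of_le b4
      have rhs : ∑ h ∈ Finset.range (M + 1), (if h ≤ J ∧ 2 * (h : ℝ) < T then 0 else β h * atomLaw x T j l₁ h₁ l₂ h₂ h)
          = m₁ + usage x T j l₂ h₂ / (x / (1 - x)) * m₂ := by
        rw [Finset.sum_eq_add_of_mem h₁ h₂ (Finset.mem_range.2 hh1M) (Finset.mem_range.2 hh2M) (Nat.ne_of_lt hlt)]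
        · have n1 : ¬ (h₁ ≤ J ∧ 2 * (h₁ : ℝ) < T) := fun c => by linarith [c.2]
          have n2 : ¬ (h₂ ≤ J ∧ 2 * (h₂ : ℝ) < T) := fun c => by omega
          rw [if_neg n1, if_neg n2]
          have hb1 : β h₁ = 1 / usage x T j l₁ h₁ := by
            show (if h₁ = h₁ then _ else if h₁ = h₂ then _ else _) = _
            rw [if_pos rfl]
          have hb2 : β h₂ = (1 - x) / x := by
            show (if h₂ = h₁ then _ else if h₂ = h₂ then _ else _) = _
            rw [if_neg (Nat.ne_of_lt hlt).symm, if_pos rfl]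
          rw [hb1, hb2, e3, e4, hm₁, hm₂]
          field_simp
        · intro c _ hc
          by_cases hcl : c ≤ J ∧ 2 * (c : ℝ) < T
          · rw [if_pos hcl]
          · rw [if_neg hcl]
            by_cases hc1 : c = l₁
            · exfalso; exact hcl ⟨by omega, by rw [hc1]; exact a2⟩
            by_cases hc2 : c = l₂
            · exfalso; exact hcl ⟨by omega, by rw [hc2]; exact b2⟩
            rw [hμ0 c hc1 hc2 hc.1 hc.2, mul_zero]
      rw [lhs, rhs] at hdual
      have : usage x T j l₂ h₂ / (x / (1 - x)) < 1 := (div_lt_one hu).2 c2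
      nlinarith
    · -- the price inequalities
      simp only [α, β]
      by_cases hl' : l = l₁ ∨ l = l₂
      · rw [if_pos hl']
        have hlh : l < h := by
          rcases hcomp with hg | hm
          · omega
          · by_contra hge; push Not at hge
            have : (h : ℝ) ≤ l := by exact_mod_cast hge
            linarith
        have hpos : 0 < usage x T J l h := usage_pos_of_compat x T J l h hx0 hx1 hlow hlh hcomp
        by_cases e₁ : h = h₁
        · rw [if_pos e₁, e₁]
          rcases hl' with e | e
          · rw [e, hcJ₁]; field_simp; exact le_rfl
          · have hm : T < (l₂ : ℝ) + h₁ := by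
              rcases hcomp with hg | hm
              · exfalso; omega
              · rw [e, e₁] at hm; exact hm
            rw [e]
            calc (1 : ℝ) = usage x T j l₁ h₁ * (1 / usage x T j l₁ h₁) := by field_simp
              _ ≤ usage x T J l₂ h₁ * (1 / usage x T j l₁ h₁) :=
                mul_le_mul_of_nonneg_right (hcJ₂₁ hm) (one_div_pos.2 hc₁pos).le
        · rw [if_neg e₁]
          by_cases e₂ : h = h₂
          · rw [if_pos e₂, e₂, hcJ₂ l]; field_simp; exact le_rfl
          · rw [if_neg e₂]; exact hBge l h hl' hhM hpos
      · rw [if_neg hl']; exact mul_nonneg (by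
          have hlh : l < h := by
            rcases hcomp with hg | hm
            · omega
            · by_contra hge; push Not at hge
              have : (h : ℝ) ≤ l := by exact_mod_cast hge
              linarith
          exact (usage_pos_of_compat x T J l h hx0 hx1 hlow hlh hcomp).le) (hβ0 h)

end LawDec

end Quant

end Summit.CriticalPhenomena.PercolationContinuityZ3.Theorems
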